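import Literature.MathematicalPhysics.QuantumFieldTheory.CubicalChainsPoincareOne
import Literature.MathematicalPhysics.QuantumFieldTheory.CubicalChainsHodge
import HarnessLib

/-!
# 1-chains on boxes of `ℤ^d` with coefficients in an abelian group: the sweep and its homotopy
# formula

Coefficient generalisation of `CubicalChainsPoincareOne.lean` (Fröhlich–Spencer's support-controlled
Poincaré lemma, FS82 §2.3 Lemma 1 p. 421, in chain degree one), from `ℤ`-valued to `A`-valued
chains for an arbitrary additive commutative group `A` — e.g. a finite abelian group of 't Hooft
fluxes / centre-valued monopole currents — WITHOUT the `ℓ¹ → ℓ^∞` bound of the integer statement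
(meaningless for general `A`). The proofs are the same sweep, with the integer arithmetic on VALUES
replaced by abelian-group algebra (the lattice coordinates stay in `ℤ`); since `A` may have
`2`-torsion, "alternating" is carried as the pair of conditions `M y j i = -M y i j`, `M y i i = 0`
(the shape of `LatticeForm.IsAlt`).

* `LatticeChain.div₁` (the boundary of an `A`-valued 1-chain, degree-one companion of `div₂`,
  `div₃`, `div₄` of `CubicalChainsHodge.lean`; over `ℤ` it is `bd₁`), and
  `div₁_div₂ : div₁ (div₂ M) = 0` for `M` antisymmetric with zero diagonal (any coefficients).
* `LatticeChain.Coeff.colAbove₁ / sweepH₁ / sweepπ₁`: the column sums, prism and floor projection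
  of the sweep in a direction `ℓ` of `CubicalChainsPoincareOne`, with coefficients; their supports
  (`Coeff.sweep_supports₁`), the homotopy formula
  `Coeff.eq_div₂_sweepH₁_add_sweepπ₁ : ρ = ∂(hρ) + πρ` for a closed `ρ` supported in a box, and
  `Coeff.div₁_sweepπ₁` (the floor projection of a closed chain is closed).

The induction over the directions (closed `A`-valued 1-chains in a box are boundaries of 2-chains
in the box) and its transport to cochain degree three on `ℤ⁴` are in `CubicalStarFourCoeff.lean`.
Everything is proved; no named fact is introduced.

## References

* J. Fröhlich, T. Spencer, Comm. Math. Phys. 83 (1982) 411–454, §2.3 Lemma 1 (p. 421: Poincaré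
  lemma with supports, forms with values in `K`), §2.7 (2.56). [FrohlichSpencerCMP1982]
-/

noncomputable section

open Finset Function Literature.Probability.LatticeModels

namespace Literature.MathematicalPhysics.QuantumFieldTheory

namespace LatticeChain

open LatticeForm (e)

variable {d : ℕ} {A : Type*} [AddCommGroup A]

/-! ### The boundary of a 1-chain with coefficients -/

/-- **The boundary of a 1-chain with coefficients in `A`**: `div₁ ρ y = ∑_k (ρ (y - e_k) k - ρ y k)`
(minus the lattice divergence of the current `ρ` at the site `y`). [folklore] -/
def div₁ (ρ : Site d → Fin d → A) : Site d → A :=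
  fun y => ∑ k, (ρ (y - e k) k - ρ y k)

/-- Over `ℤ`, `div₁` is `bd₁`. [folklore] -/
theorem div₁_eq_bd₁ (ρ : Site d → Fin d → ℤ) : div₁ ρ = bd₁ ρ := rfl

/-- `div₁` of a difference. [folklore] -/
theorem div₁_sub (ρ ρ' : Site d → Fin d → A) : div₁ (ρ - ρ') = div₁ ρ - div₁ ρ' := by
  funext y
  simp only [div₁, Pi.sub_apply, ← Finset.sum_sub_distrib]
  exact Finset.sum_congr rfl fun j _ => by abel

/-- A double sum `∑_k ∑ⱼ M (f j k) j k` with `(j,k)`-symmetric sites `f` vanishes for `M`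
antisymmetric with zero diagonal, over any coefficient group (pair `(j, k)` with `(k, j)`).
[folklore] -/
theorem sum_sum_eq_zero_of_symm_of_diag {M : Site d → Fin d → Fin d → A}
    (hanti : ∀ y i j, M y j i = -M y i j) (hdiag : ∀ y i, M y i i = 0)
    (f : Fin d → Fin d → Site d) (hf : ∀ j k, f j k = f k j) :
    ∑ k, ∑ j, M (f j k) j k = 0 := by
  calc ∑ k, ∑ j, M (f j k) j k = ∑ p : Fin d × Fin d, M (f p.2 p.1) p.2 p.1 :=
        (Fintype.sum_prod_type' fun k j => M (f j k) j k).symm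
    _ = 0 := by
      refine Finset.sum_ninvolution Prod.swap (fun p => ?_) (fun p hp h => hp ?_)
        (fun p => Finset.mem_univ _) Prod.swap_swap
      · simp only [Prod.fst_swap, Prod.snd_swap]
        rw [hf p.1 p.2, hanti (f p.2 p.1) p.2 p.1, add_neg_cancel]
      · have h21 : p.2 = p.1 := by simpa using congrArg Prod.fst h
        rw [h21]
        exact hdiag _ _

/-- **`∂∂ = 0` in degree one, any coefficients**: `div₁ (div₂ M) = 0` for `M` antisymmetric with
zero diagonal. [folklore] -/
theorem div₁_div₂ {M : Site d → Fin d → Fin d → A} (hanti : ∀ y i j, M y j i = -M y i j)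
    (hdiag : ∀ y i, M y i i = 0) : div₁ (div₂ M) = 0 := by
  funext y
  simp only [div₁, div₂, Pi.zero_apply, Finset.sum_sub_distrib]
  have h1 := sum_sum_eq_zero_of_symm_of_diag hanti hdiag (fun j k => y - e k - e j)
    (fun j k => by rw [sub_sub, sub_sub, add_comm])
  have h2 := sum_sum_eq_zero_of_symm_of_diag hanti hdiag (fun _ _ => y) (fun _ _ => rfl)
  have h3 : ∑ k, ∑ j, M (y - e k) j k = -∑ k, ∑ j, M (y - e j) j k := by
    conv_lhs => rw [Finset.sum_comm]
    simp only [← Finset.sum_neg_distrib]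
    refine Finset.sum_congr rfl fun j _ => Finset.sum_congr rfl fun k _ => ?_
    rw [hanti (y - e k) j k, neg_neg]
  rw [h1, h2, h3]
  abel

namespace Coeff

/-- `div₂` is additive (any coefficients; the `ℝ`-valued `LatticeChain.div₂_add` is in
`U1CoulombEnergy.lean`). [folklore] -/
theorem div₂_add (M M' : Site d → Fin d → Fin d → A) : div₂ (M + M') = div₂ M + div₂ M' := by
  funext y k
  simp only [div₂, Pi.add_apply, ← Finset.sum_add_distrib]
  exact Finset.sum_congr rfl fun j _ => by abel

/-- `div₂ 0 = 0` (any coefficients). [folklore] -/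
@[simp] theorem div₂_zero : div₂ (0 : Site d → Fin d → Fin d → A) = 0 := by
  funext y k; simp [div₂]

/-! ### Interval sums with values in `A` -/

/-- `[c, n] = {c} ∪ (c, n]` for `c ≤ n`, as a sum. [folklore] -/
theorem sum_Icc_eq_add_sum_Ioc {c n : ℤ} (h : c ≤ n) (g : ℤ → A) :
    ∑ s ∈ Finset.Icc c n, g s = g c + ∑ s ∈ Finset.Ioc c n, g s := by
  rw [← Finset.Ioc_insert_left h, Finset.sum_insert (by simp)]

/-- Telescoping over an integer interval: `∑_{s ∈ (m, n]} (g (s-1) - g s) = g m - g n`. [folklore] -/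
theorem sum_Ioc_telescope (g : ℤ → A) {m n : ℤ} (h : m ≤ n) :
    ∑ s ∈ Finset.Ioc m n, (g (s - 1) - g s) = g m - g n := by
  obtain ⟨t, rfl⟩ : ∃ t : ℕ, n = m + t := ⟨(n - m).toNat, by omega⟩
  clear h
  induction t with
  | zero => simp
  | succ t ih =>
    have hstep : Finset.Ioc m (m + ((t + 1 : ℕ) : ℤ)) =
        insert (m + ((t + 1 : ℕ) : ℤ)) (Finset.Ioc m (m + (t : ℤ))) := by
      ext s; simp only [Finset.mem_Ioc, Finset.mem_insert, Nat.cast_succ]; omega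
    have hnot : m + ((t + 1 : ℕ) : ℤ) ∉ Finset.Ioc m (m + (t : ℤ)) := by
      simp only [Finset.mem_Ioc, Nat.cast_succ]; omega
    have h1 : m + ((t + 1 : ℕ) : ℤ) - 1 = m + (t : ℤ) := by push_cast; ring
    rw [hstep, Finset.sum_insert hnot, ih, h1]
    abel

/-! ### The sweep in one direction, degree one, with coefficients -/

section Sweep

variable (a b : Site d) (ℓ : Fin d) (ρ : Site d → Fin d → A)

/-- The column sum of `ρ(·, k)` strictly above `z` in direction `ℓ` (up to the top `b ℓ` of the
box), cut off below the floor `a ℓ`; coefficients in `A`. [folklore] -/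
def colAbove₁ (z : Site d) (k : Fin d) : A :=
  if a ℓ ≤ z ℓ then ∑ s ∈ Finset.Ioc (z ℓ) (b ℓ), ρ (update z ℓ s) k else 0

/-- **The prism (homotopy) operator of the sweep in direction `ℓ`, degree one**, coefficients in
`A`: below every link `(y, k)`, `k ≠ ℓ`, the plaquettes `(z; ℓ, k)` from the floor up to the link.
[folklore] -/
def sweepH₁ (z : Site d) (i k : Fin d) : A :=
  (if i = ℓ then colAbove₁ a b ℓ ρ z k else 0) - (if k = ℓ then colAbove₁ a b ℓ ρ z i else 0)

/-- **The floor projection of the sweep in direction `ℓ`, degree one**, coefficients in `A`: the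
links not in direction `ℓ`, summed along their column and placed on the floor `y ℓ = a ℓ`.
[folklore] -/
def sweepπ₁ (y : Site d) (k : Fin d) : A :=
  if k ≠ ℓ ∧ y ℓ = a ℓ then ∑ s ∈ Finset.Icc (a ℓ) (b ℓ), ρ (update y ℓ s) k else 0

variable {a b ℓ ρ}

/-- Outside the slab `a ℓ ≤ y ℓ ≤ b ℓ` there is nothing. [folklore] -/
theorem eq_zero_of_lt_or_lt₁ (hsupp : ∀ y k, ρ y k ≠ 0 → a ≤ y ∧ y + e k ≤ b) {y : Site d}
    (hy : y ℓ < a ℓ ∨ b ℓ < y ℓ) (k : Fin d) : ρ y k = 0 := by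
  by_contra hne
  have := inBox₁_iff.1 (hsupp y k hne) ℓ
  split_ifs at this <;> omega

/-- A link in direction `ℓ` based at height `≥ b ℓ` sticks out of the box. [folklore] -/
theorem apply_update_eq_zero_of_le₁ (hsupp : ∀ y k, ρ y k ≠ 0 → a ≤ y ∧ y + e k ≤ b) (y : Site d)
    {s : ℤ} (hs : b ℓ ≤ s) : ρ (update y ℓ s) ℓ = 0 := by
  by_contra hne
  have := (inBox₁_iff.1 (hsupp _ ℓ hne) ℓ).2
  simp only [if_true, update_self] at this
  omega

/-- The prism is antisymmetric. [folklore] -/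
theorem sweepH₁_swap (y : Site d) (i k : Fin d) : sweepH₁ a b ℓ ρ y k i = -sweepH₁ a b ℓ ρ y i k := by
  simp only [sweepH₁]; abel

/-- The prism has zero diagonal. [folklore] -/
theorem sweepH₁_diag (y : Site d) (i : Fin d) : sweepH₁ a b ℓ ρ y i i = 0 := sub_self _

/-- A non-zero component of the floor projection is in a direction `k ≠ ℓ` carried by `ρ` on
the column through it. [folklore] -/
theorem sweepπ₁_ne_zero_dir {y : Site d} {k : Fin d} (h : sweepπ₁ a b ℓ ρ y k ≠ 0) :
    k ≠ ℓ ∧ y ℓ = a ℓ ∧ ∃ s ∈ Finset.Icc (a ℓ) (b ℓ), ρ (update y ℓ s) k ≠ 0 := by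
  unfold sweepπ₁ at h
  split_ifs at h with hc
  · exact ⟨hc.1, hc.2, Finset.exists_ne_zero_of_sum_ne_zero h⟩
  · exact absurd rfl h

/-- A non-zero prism coefficient comes from one of its two column sums. [folklore] -/
theorem sweepH₁_ne_zero_cases {z : Site d} {i k : Fin d} (h : sweepH₁ a b ℓ ρ z i k ≠ 0) :
    (i = ℓ ∧ colAbove₁ a b ℓ ρ z k ≠ 0) ∨ (k = ℓ ∧ colAbove₁ a b ℓ ρ z i ≠ 0) := by
  unfold sweepH₁ at h
  by_cases hi : i = ℓ
  · by_cases hk : k = ℓ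
    · subst hi; subst hk; simp at h
    · refine Or.inl ⟨hi, ?_⟩
      rwa [if_pos hi, if_neg hk, sub_zero] at h
  · by_cases hk : k = ℓ
    · refine Or.inr ⟨hk, ?_⟩
      rwa [if_neg hi, if_pos hk, zero_sub, neg_ne_zero] at h
    · rw [if_neg hi, if_neg hk, sub_zero] at h
      exact absurd rfl h

/-- **Supports of the sweep operators**: if the links of `ρ` lie in the box `[a, b]`, so do the
plaquettes `(z; ℓ, k)` of the non-zero column sums, the plaquettes of the prism and the links of
the floor projection. [folklore] -/
theorem sweep_supports₁ (hsupp : ∀ y k, ρ y k ≠ 0 → a ≤ y ∧ y + e k ≤ b) :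
    (∀ z k, colAbove₁ a b ℓ ρ z k ≠ 0 → a ≤ z ∧ z + e ℓ + e k ≤ b) ∧
    (∀ z i k, sweepH₁ a b ℓ ρ z i k ≠ 0 → a ≤ z ∧ z + e i + e k ≤ b) ∧
    (∀ y k, sweepπ₁ a b ℓ ρ y k ≠ 0 → a ≤ y ∧ y + e k ≤ b) := by
  have hcol : ∀ z k, colAbove₁ a b ℓ ρ z k ≠ 0 → a ≤ z ∧ z + e ℓ + e k ≤ b := by
    intro z k hc
    unfold colAbove₁ at hc
    split_ifs at hc with hz
    · obtain ⟨s, hs, hne⟩ := Finset.exists_ne_zero_of_sum_ne_zero hc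
      have H := inBox₁_iff.1 (hsupp _ k hne)
      rw [Finset.mem_Ioc] at hs
      have Hℓ := H ℓ
      rw [update_self] at Hℓ
      refine inBox₂_iff.2 fun m => ?_
      have Hm := H m
      by_cases hm : m = ℓ
      · subst hm
        rw [if_pos rfl]
        split_ifs at Hℓ <;> omega
      · rw [update_of_ne hm] at Hm
        rw [if_neg hm]
        omega
    · exact absurd rfl hc
  refine ⟨hcol, fun z i k h => ?_, fun y k h => ?_⟩
  · rcases sweepH₁_ne_zero_cases h with ⟨hi, hc⟩ | ⟨hk, hc⟩
    · rw [hi]; exact hcol z k hc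
    · obtain ⟨h1, h2⟩ := hcol z i hc
      rw [hk]
      refine ⟨h1, ?_⟩
      have : z + e i + e ℓ = z + e ℓ + e i := by abel
      rw [this]; exact h2
  · obtain ⟨hk, hy, s, hs, hne⟩ := sweepπ₁_ne_zero_dir h
    have H := inBox₁_iff.1 (hsupp _ k hne)
    rw [Finset.mem_Icc] at hs
    refine inBox₁_iff.2 fun m => ?_
    have Hm := H m
    by_cases hm : m = ℓ
    · subst hm
      rw [update_self, if_neg (Ne.symm hk)] at Hm
      rw [if_neg (Ne.symm hk), hy]
      omega
    · rwa [update_of_ne hm] at Hm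

/-! #### The homotopy formula for closed 1-chains -/

/-- The boundary of the prism on a link not in direction `ℓ`. [folklore] -/
theorem div₂_sweepH₁_of_ne {y : Site d} {k : Fin d} (hk : k ≠ ℓ) :
    div₂ (sweepH₁ a b ℓ ρ) y k = colAbove₁ a b ℓ ρ (y - e ℓ) k - colAbove₁ a b ℓ ρ y k := by
  simp only [div₂, sweepH₁, if_neg hk, sub_zero]
  rw [Finset.sum_sub_distrib, Finset.sum_ite_eq' Finset.univ ℓ, Finset.sum_ite_eq' Finset.univ ℓ]
  simp

/-- The boundary of the prism on a link in direction `ℓ`. [folklore] -/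
theorem div₂_sweepH₁_self (y : Site d) :
    div₂ (sweepH₁ a b ℓ ρ) y ℓ =
      -∑ j ∈ Finset.univ.erase ℓ, (colAbove₁ a b ℓ ρ (y - e j) j - colAbove₁ a b ℓ ρ y j) := by
  simp only [div₂, sweepH₁, if_true]
  set g : Fin d → A := fun j => colAbove₁ a b ℓ ρ (y - e j) j - colAbove₁ a b ℓ ρ y j with hg
  have h1 : ∀ j, ((if j = ℓ then colAbove₁ a b ℓ ρ (y - e j) ℓ else 0) - colAbove₁ a b ℓ ρ (y - e j) j -
      ((if j = ℓ then colAbove₁ a b ℓ ρ y ℓ else 0) - colAbove₁ a b ℓ ρ y j)) =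
      (if j = ℓ then g ℓ else 0) - g j := by
    intro j
    by_cases hj : j = ℓ
    · subst hj; simp [hg]
    · simp only [if_neg hj, hg]; abel
  rw [Finset.sum_congr rfl fun j _ => h1 j, Finset.sum_sub_distrib, Finset.sum_ite_eq' Finset.univ ℓ,
    if_pos (Finset.mem_univ ℓ), ← Finset.add_sum_erase Finset.univ g (Finset.mem_univ ℓ)]
  abel

/-- **Closedness, summed along a column** (coefficients in `A`): for a closed 1-chain in the box,
`ρ y ℓ` (base point not below the floor) is minus the sum over `j ≠ ℓ` of the differences of the
column sums of `ρ(·, j)` above `y - eⱼ` and above `y`. [folklore] -/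
theorem apply_self_eq_of_closed (hcl : div₁ ρ = 0)
    (hsupp : ∀ y k, ρ y k ≠ 0 → a ≤ y ∧ y + e k ≤ b) {y : Site d} (hy : a ℓ ≤ y ℓ) :
    ρ y ℓ = -∑ j ∈ Finset.univ.erase ℓ, (colAbove₁ a b ℓ ρ (y - e j) j - colAbove₁ a b ℓ ρ y j) := by
  have h0 : ∑ s ∈ Finset.Ioc (y ℓ) (b ℓ), ∑ j, (ρ (update y ℓ s - e j) j - ρ (update y ℓ s) j) = 0 :=
    Finset.sum_eq_zero fun s _ => by
      have := congrFun hcl (update y ℓ s)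
      simpa only [div₁, Pi.zero_apply] using this
  rw [Finset.sum_comm, ← Finset.add_sum_erase Finset.univ _ (Finset.mem_univ ℓ)] at h0
  have hℓ : ∑ s ∈ Finset.Ioc (y ℓ) (b ℓ), (ρ (update y ℓ s - e ℓ) ℓ - ρ (update y ℓ s) ℓ) = ρ y ℓ := by
    rcases le_or_gt (y ℓ) (b ℓ) with hyb | hyb
    · have ht := sum_Ioc_telescope (fun s => ρ (update y ℓ s) ℓ) hyb
      have hrw : ∀ s, ρ (update y ℓ s - e ℓ) ℓ = ρ (update y ℓ (s - 1)) ℓ := fun s => by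
        rw [update_pred]
      simp_rw [hrw]
      rw [ht, update_eq_self, apply_update_eq_zero_of_le₁ hsupp y le_rfl, sub_zero]
    · have h0 := apply_update_eq_zero_of_le₁ hsupp y hyb.le
      rw [update_eq_self] at h0
      rw [Finset.Ioc_eq_empty (by omega), Finset.sum_empty, h0]
  have hj : ∀ j ∈ Finset.univ.erase ℓ,
      ∑ s ∈ Finset.Ioc (y ℓ) (b ℓ), (ρ (update y ℓ s - e j) j - ρ (update y ℓ s) j) =
        colAbove₁ a b ℓ ρ (y - e j) j - colAbove₁ a b ℓ ρ y j := by
    intro j hj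
    have hjℓ : j ≠ ℓ := Finset.ne_of_mem_erase hj
    have hyj : (y - e j) ℓ = y ℓ := by rw [sub_e_apply, if_neg (Ne.symm hjℓ), sub_zero]
    simp only [colAbove₁, hyj, if_pos hy, Finset.sum_sub_distrib]
    congr 1
    exact Finset.sum_congr rfl fun s _ => by rw [update_sub_e_of_ne y hjℓ]
  rw [hℓ, Finset.sum_congr rfl hj] at h0
  exact eq_neg_of_add_eq_zero_left h0

/-- **The homotopy formula of the sweep for closed 1-chains** (coefficients in `A`): a closed
1-chain whose links lie in the box `[a, b]` is the boundary of its prism plus its floor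
projection, `ρ = ∂(hρ) + πρ`. [folklore] -/
theorem eq_div₂_sweepH₁_add_sweepπ₁ (hcl : div₁ ρ = 0)
    (hsupp : ∀ y k, ρ y k ≠ 0 → a ≤ y ∧ y + e k ≤ b) :
    ρ = div₂ (sweepH₁ a b ℓ ρ) + sweepπ₁ a b ℓ ρ := by
  funext y k
  simp only [Pi.add_apply]
  by_cases hk : k = ℓ
  · subst hk
    rw [show sweepπ₁ a b k ρ y k = 0 by simp [sweepπ₁], add_zero, div₂_sweepH₁_self]
    rcases le_or_gt (a k) (y k) with hy | hy
    · exact apply_self_eq_of_closed hcl hsupp hy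
    · rw [eq_zero_of_lt_or_lt₁ hsupp (Or.inl hy)]
      symm
      rw [neg_eq_zero]
      refine Finset.sum_eq_zero fun j hj => ?_
      have hjℓ : j ≠ k := Finset.ne_of_mem_erase hj
      have hyj : (y - e j) k = y k := by rw [sub_e_apply, if_neg (Ne.symm hjℓ), sub_zero]
      simp only [colAbove₁, hyj, if_neg (not_le.2 hy), sub_self]
  · rw [div₂_sweepH₁_of_ne hk]
    simp only [colAbove₁, sweepπ₁, sub_e_apply, if_true, update_sub_e_self, Ne, hk,
      not_false_eq_true, true_and]
    rcases lt_trichotomy (y ℓ) (a ℓ) with hy | hy | hy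
    · rw [if_neg (by omega), if_neg (by omega), if_neg (by omega),
        eq_zero_of_lt_or_lt₁ hsupp (Or.inl hy)]
      simp
    · rw [if_neg (by omega), if_pos hy.ge, if_pos hy, zero_sub]
      rcases le_or_gt (a ℓ) (b ℓ) with hab | hab
      · rw [sum_Icc_eq_add_sum_Ioc hab, ← hy, update_eq_self]
        abel
      · rw [Finset.Ioc_eq_empty (by omega), Finset.Icc_eq_empty (by omega), Finset.sum_empty,
          eq_zero_of_lt_or_lt₁ (ℓ := ℓ) hsupp (Or.inr (by omega))]
        simp
    · rw [if_pos (by omega), if_pos hy.le, if_neg (by omega), add_zero, Ioc_pred_eq_Icc]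
      rcases le_or_gt (y ℓ) (b ℓ) with hyb | hyb
      · rw [sum_Icc_eq_add_sum_Ioc hyb, update_eq_self]
        abel
      · rw [Finset.Ioc_eq_empty (by omega), Finset.Icc_eq_empty (by omega), Finset.sum_empty,
          eq_zero_of_lt_or_lt₁ hsupp (Or.inr hyb)]
        simp

/-- The floor projection of a closed 1-chain is closed (`∂πρ = ∂ρ - ∂∂hρ = 0`). [folklore] -/
theorem div₁_sweepπ₁ (hcl : div₁ ρ = 0) (hsupp : ∀ y k, ρ y k ≠ 0 → a ≤ y ∧ y + e k ≤ b) :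
    div₁ (sweepπ₁ a b ℓ ρ) = 0 := by
  have h := eq_div₂_sweepH₁_add_sweepπ₁ (ℓ := ℓ) hcl hsupp
  have h' : sweepπ₁ a b ℓ ρ = ρ - div₂ (sweepH₁ a b ℓ ρ) := by
    rw [eq_sub_iff_add_eq, add_comm, ← h]
  rw [h', div₁_sub, hcl, div₁_div₂ (M := sweepH₁ a b ℓ ρ) sweepH₁_swap sweepH₁_diag, sub_zero]

end Sweep

end Coeff

end LatticeChain

end Literature.MathematicalPhysics.QuantumFieldTheory
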